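import Mathlib.AlgebraicGeometry.Morphisms.UniversallyClosed
import Mathlib.AlgebraicGeometry.AffineSpace
import HarnessLib

/-!
# Universally closed morphisms: the affine-space test (Stacks Project, Tag 05JX)

A quasi-compact morphism of schemes `f : X → S` is universally closed as soon as the base
changes `𝐀ⁿ × X → 𝐀ⁿ × S` (`n ≥ 0`) are all closed maps: The Stacks Project, Tag 05JX (Limits of
Schemes, Lemma 32.14.2), whose printed statement is

> Let `f : X → S` be a quasi-compact morphism of schemes. The following are equivalent:
> (1) `f` is universally closed, (2) for every morphism `S' → S` which is locally of finite
> presentation the base change `X_{S'} → S'` is closed, and (3) for every `n` the morphism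
> `𝐀ⁿ × X → 𝐀ⁿ × S` is closed.

(Proof there: (2) ⇒ (1) by Schemes, Lemma 26.19.8 and Limits, Lemma 32.14.1; (3) ⇒ (2) by
embedding an affine `S'` into some `𝐀ⁿ` over an affine open of `S`, Morphisms, Lemma 29.22.2.)

We vendor the equivalence (1) ⇔ (3) as the named fact
`Literature.AlgebraicGeometry.Morphisms.universallyClosed_iff_isClosedMap_affineSpaceMap` (a sorry-free `Prop`
definition, never asserted; users take it as a hypothesis `(h : …)`), with `𝐀ⁿ × X → 𝐀ⁿ × S`
spelled as Mathlib's `AffineSpace.map n f : 𝔸(n; X) ⟶ 𝔸(n; S)` (a base change of `f`: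
`AffineSpace.isPullback_map`). The easy direction (1) ⇒ (3) is proved
(`Literature.AlgebraicGeometry.Morphisms.isClosedMap_affineSpaceMap_of_universallyClosed`).

It is used (direction (3) ⇒ (1), with `S = Spec k`) in the proof of the GAGA comparison
"`X(ℂ)` compact ⇒ `X` proper" (`Literature/NumberTheory/Transcendental/AnalytificationProper.lean`,
following SGA1 XII Prop. 3.2 (v)), where closedness of `(X ×ₖ 𝔸ⁿₖ)(ℂ) → 𝔸ⁿₖ(ℂ)` comes from
compactness of `X(ℂ)`.

## Mathlib

Mathlib has `UniversallyClosed` (`= universally (topologically IsClosedMap)`), its stability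
under base change, `Scheme.Hom.isClosedMap`, `compactSpace_of_universallyClosed`,
`Scheme.Hom.isProperMap` (Tag 04XU), the valuative criterion
(`UniversallyClosed.of_valuativeCriterion`) and `universallyClosed_eq_universallySpecializing`,
but not Tag 05JX (searched `05JX`, `AffineSpace.map` under `Mathlib/AlgebraicGeometry/Morphisms`:
no hits).

## References

* The Stacks Project, Tag 05JX (Limits of Schemes, Lemma 32.14.2); Tag 05JW (Lemma 32.14.1).
-/

noncomputable section

open CategoryTheory AlgebraicGeometry

universe u

namespace Literature.AlgebraicGeometry.Morphisms

/-- NAMED FACT — **universal closedness is tested on affine spaces** (The Stacks Project,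
Tag 05JX = Limits of Schemes, Lemma 32.14.2, (1) ⇔ (3)): "Let `f : X → S` be a quasi-compact
morphism of schemes. The following are equivalent: (1) `f` is universally closed, […], (3) for
every `n` the morphism `𝐀ⁿ × X → 𝐀ⁿ × S` is closed." Here `𝐀ⁿ × X → 𝐀ⁿ × S` is Mathlib's
`AffineSpace.map n f : 𝔸(n; X) ⟶ 𝔸(n; S)`, and (3) is recorded for every finite index type
`n : Type u` instead of `n = {1, …, m}` (the same condition up to the reindexing isomorphisms
`AffineSpace.reindex`; formally the right-hand side asks more, so the equivalence as stated is
formally implied by the printed one). Direction (1) ⇒ (3) is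
`isClosedMap_affineSpaceMap_of_universallyClosed`; users of (3) ⇒ (1) take
`(h : universallyClosed_iff_isClosedMap_affineSpaceMap)`.
[cite: StacksProject, Tag 05JX (Limits, Lemma 32.14.2)] -/
def universallyClosed_iff_isClosedMap_affineSpaceMap : Prop :=
  ∀ ⦃X S : Scheme.{u}⦄ (f : X ⟶ S) [QuasiCompact f],
    UniversallyClosed f ↔ ∀ (n : Type u) [Finite n], IsClosedMap (AffineSpace.map n f)

/-- Direction (1) ⇒ (3) of Stacks 05JX, proved: every base change `𝔸(n; X) → 𝔸(n; S)` of a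
universally closed morphism `f : X → S` is a closed map (`AffineSpace.isPullback_map`: it is a
base change of `f`; Mathlib: `UniversallyClosed` is stable under base change and implies
`IsClosedMap`). No finiteness of `n` or quasi-compactness of `f` is needed for this direction.
[cite: StacksProject, Tag 05JX (Limits, Lemma 32.14.2)] -/
theorem isClosedMap_affineSpaceMap_of_universallyClosed {X S : Scheme.{u}} (f : X ⟶ S)
    [UniversallyClosed f] (n : Type u) : IsClosedMap (AffineSpace.map n f) := by
  have : UniversallyClosed (AffineSpace.map n f) :=
    MorphismProperty.of_isPullback (P := @UniversallyClosed)
      (AffineSpace.isPullback_map f).flip ‹UniversallyClosed f›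
  exact (AffineSpace.map n f).isClosedMap

end Literature.AlgebraicGeometry.Morphisms

end
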